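import Literature.NumberTheory.Sieve.RoughOmegaCellsClassesBVPrimesAux
import Literature.NumberTheory.Sieve.MoebiusResidueClassSums

/-!
# SoloInformedMoebiusSWHypAux — Möbius log-power pieces: definitions and the three estimates
# behind their Siegel–Walfisz hypothesis (A₂)

Solo unit `solo-Parity-informed` (ideation tier, informed mode), session 76; `paper.md` §20
(Theorem 20.1 = (F′), step (1b)), PLAN §60 (file F2, auxiliary half), CLAIMS C144/C145.

This file carries everything of file F2 except the final case analysis, which is
`SoloInformedMoebiusSWHyp.lean` (`siegelWalfiszHyp_moebiusLogPiece`):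

1. the MÖBIUS LOG-POWER PIECES `moebiusLogPiece j r₀ a b : n ↦ 𝟙[a < n ≤ b] 𝟙[(n, r₀) = 1] μ(n) (log n)^j`
   and their pointwise bounds (`|β_n| ≤ |log n|^j`, `|β_n| ≤ β_n²` once `log n ≥ 1`,
   `|β_n| ≤ (log 2N)^j` on the dyadic block), plus the rewriting of the filtered dyadic sums of a
   piece as sums over `(a, b]` (`sum_filter_dyadic_moebiusLogPiece`);
2. ITERATED PARTIAL SUMMATION against `log^j` (`abs_sum_Ioc_mul_log_pow_le`,
   `abs_sum_Ioc_ite_moebius_log_pow_le`): a uniform bound `M` for the partial sums `Σ_{n ≤ t} c_n`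
   gives `|Σ_{a<n≤t} c_n (log n)^j| ≤ 2^{j+1} M (log b)^j` — iterating the `j = 1` step
   `BVMoebius.abs_sum_Ioc_mul_log_le`;
3. the LARGE-MODULI bound (`disc_le_large_moduli_of_abs_le`): for `k > (log 2N)^{4A}` the trivial
   count of `BombieriFriedlanderIwaniecSiegelWalfisz.lean` times `max |β| ≤ Mx`, with
   `1/φ(k) ≤ τ(k)/k ≤ C_τ k^{−1/2}`, gives `|Δ| ≤ (3 C_τ + 3) Mx N (log 2N)^{−2A}`;
4. the SMALL-MODULI BOOKKEEPING (`small_moduli_bookkeeping'`): the two Siegel–Walfisz bounds (class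
   sum and coprime sum, each `≪ 4^{ω(·)} N L^{−(10A+5j)} L^j`) combine to
   `|T₁ − T₂/φ(k)| ≤ 2^{j+3} C_P 4^{ω(r₀)} 4^{ω(d)} N L^{−2A}` when `k ≤ L^{4A+2j}`.
All inputs are PROVED Literature theorems / Mathlib; no hypothesis is assumed.
-/

namespace Summit.Parity.BatemanHorn.Theorems

open Finset Real Filter
open scoped ArithmeticFunction.Moebius ArithmeticFunction.sigma
open Literature.NumberTheory.Sieve Literature.NumberTheory.Sieve.BFI

/-! ### 1. The pieces -/

/-- The Möbius log-power piece `β_n = 𝟙[a < n ≤ b] 𝟙[(n, r₀) = 1] μ(n) (log n)^j`. -/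
noncomputable def moebiusLogPiece (j r₀ a b : ℕ) (n : ℕ) : ℝ :=
  if a < n ∧ n ≤ b ∧ n.Coprime r₀ then (μ n : ℝ) * Real.log n ^ j else 0

/-- The piece vanishes off `(a, b]`. -/
theorem moebiusLogPiece_eq_zero_of_not_mem {j r₀ a b n : ℕ} (h : n ∉ Ioc a b) :
    moebiusLogPiece j r₀ a b n = 0 := by
  unfold moebiusLogPiece
  rw [if_neg]
  intro h'
  exact h (mem_Ioc.2 ⟨h'.1, h'.2.1⟩)

/-- A point where the piece is non-zero lies in `(a, b]`. -/
theorem mem_Ioc_of_moebiusLogPiece_ne_zero {j r₀ a b n : ℕ} (h : moebiusLogPiece j r₀ a b n ≠ 0) :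
    n ∈ Ioc a b := by
  by_contra h'
  exact h (moebiusLogPiece_eq_zero_of_not_mem h')

/-- `|β_n| ≤ |log n|^j`. -/
theorem abs_moebiusLogPiece_le (j r₀ a b n : ℕ) :
    |moebiusLogPiece j r₀ a b n| ≤ |Real.log n| ^ j := by
  unfold moebiusLogPiece
  split_ifs
  · rw [abs_mul, abs_pow]
    have h1 : |(μ n : ℝ)| ≤ 1 := by exact_mod_cast ArithmeticFunction.abs_moebius_le_one
    calc |(μ n : ℝ)| * |Real.log n| ^ j ≤ 1 * |Real.log n| ^ j :=
          mul_le_mul_of_nonneg_right h1 (by positivity)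
      _ = |Real.log n| ^ j := one_mul _
  · rw [abs_zero]; positivity

/-- `|β_n| ≤ β_n²` as soon as `log n ≥ 1` (`μ(n)² = |μ(n)|`, `(log n)^j ≤ (log n)^{2j}`). -/
theorem abs_moebiusLogPiece_le_sq {j r₀ a b n : ℕ} (hn : 1 ≤ Real.log n) :
    |moebiusLogPiece j r₀ a b n| ≤ moebiusLogPiece j r₀ a b n ^ 2 := by
  unfold moebiusLogPiece
  split_ifs
  · rw [abs_mul, abs_pow, abs_of_nonneg (by linarith : (0 : ℝ) ≤ Real.log n), mul_pow]
    have hμ : |(μ n : ℝ)| = (μ n : ℝ) ^ 2 := by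
      rcases ArithmeticFunction.moebius_eq_or n with h | h | h <;> simp [h]
    rw [hμ, ← pow_mul]
    refine mul_le_mul_of_nonneg_left ?_ (sq_nonneg _)
    exact pow_le_pow_right₀ hn (by omega)
  · simp

/-- On `n ≥ 1` with `n ≤ 2N`: `|β_n| ≤ (log 2N)^j`. -/
theorem abs_moebiusLogPiece_le_log {j r₀ a b n : ℕ} {N : ℝ} (hn1 : 1 ≤ n) (hn : (n : ℝ) ≤ 2 * N) :
    |moebiusLogPiece j r₀ a b n| ≤ Real.log (2 * N) ^ j := by
  refine (abs_moebiusLogPiece_le j r₀ a b n).trans ?_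
  have h0 : 0 ≤ Real.log n := Real.log_natCast_nonneg n
  rw [abs_of_nonneg h0]
  exact pow_le_pow_left₀ h0 (Real.log_le_log (by exact_mod_cast hn1) hn) j

/-- Support: if `N < a + 1` and `b ≤ 2N` then `(a, b] ⊆ (N, 2N]`. -/
theorem Ioc_subset_dyadic {N : ℝ} (hN : 0 ≤ N) {a b : ℕ} (ha : N < (a : ℝ) + 1) (hb : (b : ℝ) ≤ 2 * N) :
    Ioc a b ⊆ dyadic N := by
  intro n hn
  rw [mem_Ioc] at hn
  rw [mem_dyadic hN]
  constructor
  · have : (a : ℝ) + 1 ≤ n := by exact_mod_cast hn.1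
    linarith
  · have : (n : ℝ) ≤ b := by exact_mod_cast hn.2
    linarith

/-- The filtered dyadic sums of a piece are sums over `(a, b]` of `μ (log)^j` with the condition
joined to the coprimality with `r₀`. -/
theorem sum_filter_dyadic_moebiusLogPiece {N : ℝ} (hN : 0 ≤ N) {j r₀ a b : ℕ} (ha : N < (a : ℝ) + 1)
    (hb : (b : ℝ) ≤ 2 * N) (P : ℕ → Prop) [DecidablePred P] :
    ∑ n ∈ (dyadic N).filter P, moebiusLogPiece j r₀ a b n =
      ∑ n ∈ Ioc a b, (if P n ∧ n.Coprime r₀ then (μ n : ℝ) else 0) * Real.log n ^ j := by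
  have hsub := Ioc_subset_dyadic hN ha hb (a := a) (b := b)
  rw [Finset.sum_filter]
  have h1 : ∑ n ∈ dyadic N, (if P n then moebiusLogPiece j r₀ a b n else 0) =
      ∑ n ∈ Ioc a b, (if P n then moebiusLogPiece j r₀ a b n else 0) := by
    refine (Finset.sum_subset hsub ?_).symm
    intro n _ hn
    rw [moebiusLogPiece_eq_zero_of_not_mem hn]
    simp
  rw [h1]
  refine Finset.sum_congr rfl fun n hn => ?_
  rw [mem_Ioc] at hn
  unfold moebiusLogPiece
  by_cases hP : P n <;> by_cases hc : n.Coprime r₀ <;> simp [hP, hc, hn.1, hn.2]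

/-! ### 2. Partial summation against `log^j` -/

/-- **Iterated partial summation**: if `|∑_{1 ≤ n ≤ t} c(n)| ≤ M` for all `t ≤ b` (`M ≥ 0`), then
for `a ≤ t ≤ b`, `|∑_{a < n ≤ t} c(n) (log n)^j| ≤ 2^{j+1} M (log b)^j`. -/
theorem abs_sum_Ioc_mul_log_pow_le {c : ℕ → ℝ} {a b : ℕ} {M : ℝ} (hM0 : 0 ≤ M)
    (hM : ∀ t, t ≤ b → |∑ n ∈ Icc 1 t, c n| ≤ M) (j : ℕ) :
    ∀ t, a ≤ t → t ≤ b → |∑ n ∈ Ioc a t, c n * Real.log n ^ j| ≤ 2 ^ (j + 1) * M * Real.log b ^ j := by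
  have hlogb : 0 ≤ Real.log (b : ℝ) := Real.log_natCast_nonneg b
  induction j with
  | zero =>
    intro t hat htb
    simp only [pow_zero, mul_one]
    have hsplit : ∑ n ∈ Icc 1 t, c n = ∑ n ∈ Icc 1 a, c n + ∑ n ∈ Ioc a t, c n := by
      rw [show Icc 1 t = Ioc 0 t from Finset.Icc_add_one_left_eq_Ioc 0 t,
        show Icc 1 a = Ioc 0 a from Finset.Icc_add_one_left_eq_Ioc 0 a]
      exact (Finset.sum_Ioc_consecutive c (Nat.zero_le a) hat).symm
    have h1 := hM t htb
    have h2 := hM a (hat.trans htb)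
    have : ∑ n ∈ Ioc a t, c n = ∑ n ∈ Icc 1 t, c n - ∑ n ∈ Icc 1 a, c n := by rw [hsplit]; ring
    rw [this]
    calc |∑ n ∈ Icc 1 t, c n - ∑ n ∈ Icc 1 a, c n| ≤ |∑ n ∈ Icc 1 t, c n| + |∑ n ∈ Icc 1 a, c n| :=
          abs_sub _ _
      _ ≤ M + M := add_le_add h1 h2
      _ = 2 ^ (0 + 1) * M := by ring
  | succ j ih =>
    intro t hat htb
    -- apply `abs_sum_Ioc_mul_log_le` to `c' n = 𝟙[a < n] c(n) (log n)^j`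
    set c' : ℕ → ℝ := fun n => if a < n then c n * Real.log n ^ j else 0 with hc'
    have hpart : ∀ s, a ≤ s → s ≤ t → |∑ n ∈ Icc 1 s, c' n| ≤ 2 ^ (j + 1) * M * Real.log b ^ j := by
      intro s has hst
      have hIcc : ∑ n ∈ Icc 1 s, c' n = ∑ n ∈ Ioc a s, c n * Real.log n ^ j := by
        rw [hc']
        rw [← Finset.sum_filter]
        refine Finset.sum_congr ?_ fun _ _ => rfl
        ext n
        simp only [mem_filter, mem_Icc, mem_Ioc]
        omega
      rw [hIcc]
      exact ih s has (hst.trans htb)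
    have hM'0 : 0 ≤ 2 ^ (j + 1) * M * Real.log b ^ j := by positivity
    have h := BVMoebius.abs_sum_Ioc_mul_log_le (c := c') (N' := a) (N := t) hM'0 hpart
    have hsum : ∑ n ∈ Ioc a t, c' n * Real.log n = ∑ n ∈ Ioc a t, c n * Real.log n ^ (j + 1) := by
      refine Finset.sum_congr rfl fun n hn => ?_
      have han : a < n := (mem_Ioc.1 hn).1
      simp only [hc', if_pos han]
      ring
    rw [hsum] at h
    refine h.trans ?_
    have hlogt : Real.log (t : ℝ) ≤ Real.log b := by
      rcases Nat.eq_zero_or_pos t with rfl | ht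
      · simp [hlogb]
      · exact Real.log_le_log (by exact_mod_cast ht) (by exact_mod_cast htb)
    have hlogt0 : 0 ≤ Real.log (t : ℝ) := Real.log_natCast_nonneg t
    calc 2 * (2 ^ (j + 1) * M * Real.log b ^ j) * Real.log t
        ≤ 2 * (2 ^ (j + 1) * M * Real.log b ^ j) * Real.log b :=
          mul_le_mul_of_nonneg_left hlogt (by positivity)
      _ = 2 ^ (j + 1 + 1) * M * Real.log b ^ (j + 1) := by ring

/-- From a uniform bound on the Möbius sums `|∑_{n ≤ t, Q(n)} μ(n)| ≤ M` (`1 ≤ t ≤ b`) to the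
log-power weighted sum over `(a, b]`: `|∑_{a < n ≤ b} 𝟙_Q(n) μ(n) (log n)^j| ≤ 2^{j+1} M (log b)^j`. -/
theorem abs_sum_Ioc_ite_moebius_log_pow_le {Q : ℕ → Prop} [DecidablePred Q] {a b : ℕ} {M : ℝ}
    (hM0 : 0 ≤ M)
    (hM : ∀ t : ℕ, 1 ≤ t → t ≤ b → |∑ n ∈ (Icc 1 t).filter Q, (μ n : ℝ)| ≤ M) (j : ℕ) (hab : a ≤ b) :
    |∑ n ∈ Ioc a b, (if Q n then (μ n : ℝ) else 0) * Real.log n ^ j| ≤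
      2 ^ (j + 1) * M * Real.log b ^ j := by
  refine abs_sum_Ioc_mul_log_pow_le (c := fun n => if Q n then (μ n : ℝ) else 0) hM0 ?_ j b hab le_rfl
  intro t htb
  rcases Nat.eq_zero_or_pos t with rfl | ht
  · simp [hM0]
  · rw [← Finset.sum_filter]
    exact hM t ht htb

/-! ### 3. Large moduli: the trivial count -/

/-- **Large moduli**: if `|β| ≤ Mx` on `n ∼ N` (`N ≥ 1`), `k > L^{4A}` (`L = log 2N ≥ 1`,
`L^{2A} ≤ N`, `A > 0`) and the class is reduced, then `|Δ| ≤ (3 C_τ + 3) Mx N L^{-2A}`, where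
`τ(k) ≤ C_τ k^{1/2}` (the proof of `RoughCellsAP.disc_le_large_moduli`, for general bounded `β`). -/
theorem disc_le_large_moduli_of_abs_le {β : ℕ → ℝ} {N A Cτ Mx : ℝ} (hN1 : 1 ≤ N) (hMx : 0 ≤ Mx)
    (hβ : ∀ n ∈ dyadic N, |β n| ≤ Mx)
    (hL1 : 1 ≤ Real.log (2 * N)) (hL2A : Real.log (2 * N) ^ (2 * A) ≤ N) (hA : 0 < A)
    (hCτ1 : 1 ≤ Cτ) (hCτ : ∀ k : ℕ, (σ 0 k : ℝ) ≤ Cτ * (k : ℝ) ^ (1 / 2 : ℝ))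
    {k : ℕ} (hk : 1 ≤ k) (hkL : Real.log (2 * N) ^ (4 * A) < k) {l : ZMod k} (hl : IsUnit l) (d : ℕ) :
    |(∑ n ∈ (dyadic N).filter (fun n : ℕ => (n : ZMod k) = l ∧ n.Coprime d), β n) -
        (∑ n ∈ (dyadic N).filter (fun n : ℕ => n.Coprime (d * k)), β n) / (Nat.totient k : ℝ)| ≤
      (3 * Cτ + 3) * Mx * (N / Real.log (2 * N) ^ (2 * A)) := by
  set L : ℝ := Real.log (2 * N) with hLdef
  have hN0 : 0 < N := by linarith
  have hlog0 : 0 < L := by linarith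
  have hk0 : (0 : ℝ) < k := by exact_mod_cast hk
  have hlarge := abs_disc_le_large (β := β) hN0.le hMx hβ hk hl d
  have hL2A0 : 0 < L ^ (2 * A) := Real.rpow_pos_of_pos hlog0 _
  have hL4 : L ^ (2 * A) ≤ L ^ (4 * A) := Real.rpow_le_rpow_of_exponent_le hL1 (by linarith)
  -- `1/φ(k) ≤ τ(k)/k ≤ Cτ / k^{1/2} ≤ Cτ / L^{2A}`
  have hφ : ((Nat.totient k : ℝ))⁻¹ ≤ Cτ / L ^ (2 * A) := by
    have h1 := inv_totient_le_sigma_zero_div k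
    have h2 : (σ 0 k : ℝ) / k ≤ Cτ * (k : ℝ) ^ (1 / 2 : ℝ) / k :=
      div_le_div_of_nonneg_right (hCτ k) hk0.le
    have h3 : Cτ * (k : ℝ) ^ (1 / 2 : ℝ) / k = Cτ / (k : ℝ) ^ (1 / 2 : ℝ) := by
      have hs : 0 < (k : ℝ) ^ (1 / 2 : ℝ) := Real.rpow_pos_of_pos hk0 _
      have hk' : (k : ℝ) ^ (1 / 2 : ℝ) * (k : ℝ) ^ (1 / 2 : ℝ) = k := by
        rw [← Real.sqrt_eq_rpow, Real.mul_self_sqrt hk0.le]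
      rw [div_eq_div_iff hk0.ne' hs.ne', mul_assoc, hk']
    have h4 : L ^ (2 * A) ≤ (k : ℝ) ^ (1 / 2 : ℝ) := by
      have := Real.rpow_le_rpow (Real.rpow_nonneg hlog0.le _) hkL.le (show (0 : ℝ) ≤ 1 / 2 by norm_num)
      rw [← Real.rpow_mul hlog0.le] at this
      convert this using 2; ring
    calc ((Nat.totient k : ℝ))⁻¹ ≤ Cτ / (k : ℝ) ^ (1 / 2 : ℝ) := by rw [← h3]; exact h1.trans h2
      _ ≤ Cτ / L ^ (2 * A) := div_le_div_of_nonneg_left (by linarith) hL2A0 h4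
  have h1 : 2 * N / k ≤ 2 * (N / L ^ (2 * A)) := by
    rw [mul_div_assoc]
    exact mul_le_mul_of_nonneg_left (div_le_div_of_nonneg_left hN0.le hL2A0 (hL4.trans hkL.le)) (by norm_num)
  have h2 : (1 : ℝ) ≤ N / L ^ (2 * A) := by rw [le_div_iff₀ hL2A0, one_mul]; exact hL2A
  have h3 : (2 * N + 1) / (Nat.totient k : ℝ) ≤ 3 * Cτ * (N / L ^ (2 * A)) := by
    rw [div_eq_mul_inv]
    calc (2 * N + 1) * ((Nat.totient k : ℝ))⁻¹ ≤ (3 * N) * (Cτ / L ^ (2 * A)) :=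
          mul_le_mul (by linarith) hφ (inv_nonneg.2 (Nat.cast_nonneg _)) (by linarith)
      _ = 3 * Cτ * (N / L ^ (2 * A)) := by ring
  calc _ ≤ (2 * N / k + 1 + (2 * N + 1) / (Nat.totient k : ℝ)) * Mx := hlarge
    _ ≤ (2 * (N / L ^ (2 * A)) + N / L ^ (2 * A) + 3 * Cτ * (N / L ^ (2 * A))) * Mx :=
        mul_le_mul_of_nonneg_right (by linarith) hMx
    _ = (3 * Cτ + 3) * Mx * (N / L ^ (2 * A)) := by ring

/-! ### 4. Small moduli: bookkeeping of the two Siegel–Walfisz bounds -/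

/-- The real-variable bookkeeping of the small-moduli case: the bounds
`|T₁| ≤ 2^{j+1} (C_P F₁ 2N L^{-(10A+5j)}) L^j`, `|T₂| ≤ 2^{j+1} (C_P F₂ 2N L^{-(10A+5j)}) L^j` with
`F₁ ≤ F_d F_r`, `F₂ ≤ F_d k² F_r`, `k ≤ L^{4A+2j}`, `φ ≥ 1` give
`|T₁ − T₂/φ| ≤ 2^{j+3} C_P F_r F_d N L^{-2A}`. -/
theorem small_moduli_bookkeeping' {T₁ T₂ φk CP F₁ F₂ Fd Fr kk N L A : ℝ} {j : ℕ}
    (hL : 1 ≤ L) (hA : 0 ≤ A) (hN : 0 ≤ N) (hCP : 0 ≤ CP) (hFd : 0 ≤ Fd) (hFr : 0 ≤ Fr)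
    (hkk0 : 0 ≤ kk) (hkk : kk ≤ L ^ (4 * A + 2 * j)) (hφ : 1 ≤ φk)
    (hF₁ : F₁ ≤ Fd * Fr) (hF₂ : F₂ ≤ Fd * kk ^ 2 * Fr)
    (h1 : |T₁| ≤ 2 ^ (j + 1) * (CP * F₁ * (2 * N) / L ^ (10 * A + 5 * j)) * L ^ j)
    (h2 : |T₂| ≤ 2 ^ (j + 1) * (CP * F₂ * (2 * N) / L ^ (10 * A + 5 * j)) * L ^ j) :
    |T₁ - T₂ / φk| ≤ 2 ^ (j + 3) * CP * Fr * Fd * (N / L ^ (2 * A)) := by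
  have hL0 : 0 < L := by linarith
  have hE0 : 0 < L ^ (10 * A + 5 * j) := Real.rpow_pos_of_pos hL0 _
  have h80 : 0 < L ^ (8 * A + 4 * j) := Real.rpow_pos_of_pos hL0 _
  have h20 : 0 < L ^ (2 * A) := Real.rpow_pos_of_pos hL0 _
  have hj0 : 0 < L ^ j := pow_pos hL0 j
  have h81 : 1 ≤ L ^ (8 * A + 4 * j) := Real.one_le_rpow hL (by positivity)
  have hkk2 : kk ^ 2 ≤ L ^ (8 * A + 4 * j) := by
    calc kk ^ 2 ≤ (L ^ (4 * A + 2 * j)) ^ 2 := pow_le_pow_left₀ hkk0 hkk 2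
      _ = L ^ (8 * A + 4 * j) := by
          rw [← Real.rpow_natCast, ← Real.rpow_mul hL0.le]
          congr 1; push_cast; ring
  -- the common majorant `G`
  set G : ℝ := CP * Fd * Fr * (2 * N) * L ^ j / L ^ (10 * A + 5 * j) * L ^ (8 * A + 4 * j) with hG
  have hbase0 : 0 ≤ CP * Fd * Fr * (2 * N) * L ^ j / L ^ (10 * A + 5 * j) := by positivity
  have hM₁G : CP * F₁ * (2 * N) / L ^ (10 * A + 5 * j) * L ^ j ≤ G := by
    calc CP * F₁ * (2 * N) / L ^ (10 * A + 5 * j) * L ^ j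
        ≤ CP * (Fd * Fr) * (2 * N) / L ^ (10 * A + 5 * j) * L ^ j := by gcongr
      _ = CP * Fd * Fr * (2 * N) * L ^ j / L ^ (10 * A + 5 * j) := by ring
      _ ≤ G := le_mul_of_one_le_right hbase0 h81
  have hM₂G : CP * F₂ * (2 * N) / L ^ (10 * A + 5 * j) * L ^ j ≤ G := by
    calc CP * F₂ * (2 * N) / L ^ (10 * A + 5 * j) * L ^ j
        ≤ CP * (Fd * kk ^ 2 * Fr) * (2 * N) / L ^ (10 * A + 5 * j) * L ^ j := by gcongr
      _ = (CP * Fd * Fr * (2 * N) * L ^ j / L ^ (10 * A + 5 * j)) * kk ^ 2 := by ring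
      _ ≤ G := mul_le_mul_of_nonneg_left hkk2 hbase0
  have h1' : |T₁| ≤ 2 ^ (j + 1) * G := by
    calc |T₁| ≤ _ := h1
      _ = 2 ^ (j + 1) * (CP * F₁ * (2 * N) / L ^ (10 * A + 5 * j) * L ^ j) := by ring
      _ ≤ 2 ^ (j + 1) * G := mul_le_mul_of_nonneg_left hM₁G (by positivity)
  have h2' : |T₂| ≤ 2 ^ (j + 1) * G := by
    calc |T₂| ≤ _ := h2
      _ = 2 ^ (j + 1) * (CP * F₂ * (2 * N) / L ^ (10 * A + 5 * j) * L ^ j) := by ring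
      _ ≤ 2 ^ (j + 1) * G := mul_le_mul_of_nonneg_left hM₂G (by positivity)
  have hG' : G = CP * Fd * Fr * (2 * N) / L ^ (2 * A) := by
    have hE : L ^ (10 * A + 5 * j) = L ^ j * L ^ (8 * A + 4 * j) * L ^ (2 * A) := by
      rw [← Real.rpow_natCast, ← Real.rpow_add hL0, ← Real.rpow_add hL0]
      congr 1; ring
    rw [hG, hE]
    field_simp
  have hφ0 : 0 < φk := by linarith
  have hT₂ : |T₂ / φk| ≤ |T₂| := by
    rw [abs_div, abs_of_pos hφ0]
    exact div_le_self (abs_nonneg _) hφ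
  calc |T₁ - T₂ / φk| ≤ |T₁| + |T₂ / φk| := abs_sub _ _
    _ ≤ 2 ^ (j + 1) * G + 2 ^ (j + 1) * G := add_le_add h1' (hT₂.trans h2')
    _ = 2 ^ (j + 3) * CP * Fr * Fd * (N / L ^ (2 * A)) := by rw [hG']; ring

end Summit.Parity.BatemanHorn.Theorems
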